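import Summits.ValiantsHypothesis.ValiantsHypothesis.Theorems.KPlusLogSqLawTridiagonalRealStaticUnitSixConcordantSharp
import Summits.ValiantsHypothesis.ValiantsHypothesis.Theorems.KPlusLogSqLawTridiagonalRealStaticUnitSixDiscordant

/-!
# Route «KPlusLogSqLaw», crux `WeakLifting` (stmt-ValiantsHypothesis-19561) — REAL side of the tridiagonal sector:
# the UNIT-COEFFICIENT sub-sector at size `6` — EXACT COUNTS in the outer-positive classes (`L₀, L₁, L₃, L₄ > 0`)

HONEST FRAMING.  Helper theorems (`--supports stmt-ValiantsHypothesis-19561 --as helper`), seat val-sym-lift-p1 (g17), cell `pub-symmetroid`,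
2026-08-28; sixth file on the row `m = 6` of the unit-coefficient sub-sector of the α register.  Two-triangle gauge `D₆ = x^E(A·B − b₂·C·D)`,
`A = 1 − b₀ − b₁`, `B = 1 − b₃ − b₄`, `C = 1 − b₀`, `D = 1 − b₄`, `b_t = x^{L_t}`, `L_t = 2f_t − d_t − d_{t+1}`.  Here ALL FOUR OUTER slopes are
positive (`L₀, L₁, L₃, L₄ > 0`: the sign classes `+ + + + +` and `+ + − + +`, middle slope `L₂` free), so on `(0, 1)` the triangles `A`, `B` decrease
strictly from `1` to `−1` through zeros `α`, `β`.  Proved here, for ALL such exponent data: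
* **POSITIVE-TRIANGLE CHAMBER** `(0, min(α, β))` (`card_posRoots_posTriangle_unit_six_eq`): EXACTLY `[L₂ > 0]` zeros — the secular product
  `(1 − b₁/C)(1 − b₃/D)` decreases strictly while `b₂` increases (`L₂ > 0`), resp. `b₂ ≥ 1 >` the product (`L₂ ≤ 0`); existence from
  `D₆(1/4) > 0 > D₆(min(α, β))`;
* **NEGATIVE-TRIANGLE CHAMBER** `(max(α, β), 1)` under `L₂ ≤ L₁ + L₃` (`card_posRoots_negTriangle_unit_six_eq_one`): EXACTLY ONE zero — the
  pairing `(|A|/b₁)(|B|/b₃) = x^{L₂−L₁−L₃}·C·D` has a strictly increasing left side and a strictly decreasing right side; existence from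
  `D₆(max(α, β)) < 0 < D₆(1) = 1`;
* **TOTAL** (`card_posRoots_unit_six_outerPos_eq`): for `L₀, L₁, L₃, L₄ > 0` and `L₂ ≤ L₁ + L₃`, the number of positive determinant zeros is EXACTLY
  `[L₂ > 0] + 1 + [L₂ > max(L₁−L₀,0) + max(L₃−L₄,0)]` (the last summand is the concordant side, `…UnitSixConcordantSharp`); in particular class
  `+ + − + +` has exactly `1` (recovering `…UnitSixChambers`) and class `+ + + + +` with `L₂ ≤ L₁ + L₃` has exactly `2` or `3`.
The complementary sub-chamber `L₂ > L₁ + L₃` of `+ + + + +` (middle link dominant) keeps an uncounted negative-triangle chamber (located: one zero,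
memo U6-CHAMBERS-liftp1g17.md).  Nothing here is an upper law for the register (α NO MOVER); nothing bears on `WeakLifting` / `TropicalB`
(stmt-19771) in their windows, Conjecture B, the Door-A registers, `MatrixDescartes` (stmt-18050) or VP ≠ VNP.
[this seat; folklore: intermediate value theorem, monotonicity]
-/

-- `Summit.ValiantsHypothesis.ValiantsHypothesis.…` repeats a component by the D-0017 layout (single-conjunct summit); the name is mandated.
set_option linter.dupNamespace false
set_option autoImplicit false

namespace Summit.ValiantsHypothesis.ValiantsHypothesis.Theorems.KPlusLogSqLaw
namespace StaticTridiagonalRealUnit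

open Polynomial Finset
open Summit.ValiantsHypothesis.ValiantsHypothesis.Theorems.KPlusLogSqLaw.StaticTridiagonalRealPotential (pathDet)

variable (d : ℕ → ℕ) (f : ℕ → ℕ)

/-! ### The triangle `1 − x^{L₀} − x^{L₁}` for positive slopes -/

/-- strictly decreasing on `(0, ∞)`. [elementary] -/
theorem triangle_strictAnti (L₀ L₁ : ℤ) (h0 : 0 < L₀) (h1 : 0 < L₁) {x y : ℝ} (hx : 0 < x) (hxy : x < y) :
    1 - y ^ L₀ - y ^ L₁ < 1 - x ^ L₀ - x ^ L₁ := by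
  have e0 := zpow_lt_zpow_left₀ h0 hx.le hxy
  have e1 := zpow_lt_zpow_left₀ h1 hx.le hxy
  linarith

/-- at `x = 1/4` the triangle is at least `1/2` (integer slopes `≥ 1`). [elementary] -/
theorem triangle_quarter_ge (L₀ L₁ : ℤ) (h0 : 0 < L₀) (h1 : 0 < L₁) :
    (1 / 2 : ℝ) ≤ 1 - (1 / 4 : ℝ) ^ L₀ - (1 / 4 : ℝ) ^ L₁ := by
  have hq0 : (0 : ℝ) < 1 / 4 := by norm_num
  have hq1 : (1 / 4 : ℝ) ≤ 1 := by norm_num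
  have le4 : ∀ L : ℤ, 0 < L → (1 / 4 : ℝ) ^ L ≤ 1 / 4 := fun L hL => by
    have := zpow_le_zpow_right_of_le_one₀ hq0 hq1 (show (1 : ℤ) ≤ L by omega)
    rwa [zpow_one] at this
  linarith [le4 L₀ h0, le4 L₁ h1]

/-- the triangle vanishes somewhere in `(1/4, 1)`. [elementary: intermediate value theorem] -/
theorem exists_triangle_root (L₀ L₁ : ℤ) (h0 : 0 < L₀) (h1 : 0 < L₁) :
    ∃ a : ℝ, 1 / 4 < a ∧ a < 1 ∧ 1 - a ^ L₀ - a ^ L₁ = 0 := by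
  obtain ⟨n₀, hn₀⟩ := Int.eq_ofNat_of_zero_le h0.le
  obtain ⟨n₁, hn₁⟩ := Int.eq_ofNat_of_zero_le h1.le
  have hcont : ContinuousOn (fun x : ℝ => 1 - x ^ n₀ - x ^ n₁) (Set.Icc (1 / 4 : ℝ) 1) := by fun_prop
  have hlo : (0 : ℝ) < 1 - (1 / 4 : ℝ) ^ n₀ - (1 / 4 : ℝ) ^ n₁ := by
    have h := triangle_quarter_ge L₀ L₁ h0 h1
    rw [hn₀, hn₁, zpow_natCast, zpow_natCast] at h
    linarith
  have hhi : 1 - (1 : ℝ) ^ n₀ - (1 : ℝ) ^ n₁ < 0 := by simp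
  obtain ⟨a, ⟨ha1, ha2⟩, ha⟩ := intermediate_value_Ioo' (show (1 / 4 : ℝ) ≤ 1 by norm_num) hcont ⟨hhi, hlo⟩
  refine ⟨a, ha1, ha2, ?_⟩
  rw [hn₀, hn₁, zpow_natCast, zpow_natCast]
  exact ha

/-! ### Uniqueness in the two chambers -/

/-- **positive-triangle chamber, uniqueness / emptiness**: for `L₀, L₁, L₃, L₄ > 0`, two zeros `0 < x < y < 1` with positive triangles are
impossible, and for `L₂ ≤ 0` there is no such zero at all. [this file] -/
theorem unit_six_posChamber_aux (L₀ L₁ L₂ L₃ L₄ : ℤ) (h0 : 0 < L₀) (h1 : 0 < L₁) (h3 : 0 < L₃) (h4 : 0 < L₄)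
    {x y : ℝ} (hx : 0 < x) (hxy : x ≤ y) (hy : y < 1)
    (hxr : (1 - x ^ L₀ - x ^ L₁) * (1 - x ^ L₃ - x ^ L₄) = x ^ L₂ * (1 - x ^ L₀) * (1 - x ^ L₄))
    (hyr : (1 - y ^ L₀ - y ^ L₁) * (1 - y ^ L₃ - y ^ L₄) = y ^ L₂ * (1 - y ^ L₀) * (1 - y ^ L₄))
    (hAx : 0 < 1 - x ^ L₀ - x ^ L₁) (hAy : 0 < 1 - y ^ L₀ - y ^ L₁) : (0 < L₂ ∧ x = y) ∨ False := by
  have hy0 : 0 < y := hx.trans_le hxy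
  have hx1 : x < 1 := hxy.trans_lt hy
  obtain ⟨fx, kx0, kx4⟩ := unit_six_secular_lt_one_pos L₀ L₁ L₂ L₃ L₄ h0 h4 hx hx1 hxr hAx
  obtain ⟨fy, ky0, ky4⟩ := unit_six_secular_lt_one_pos L₀ L₁ L₂ L₃ L₄ h0 h4 hy0 hy hyr hAy
  have cx : 0 < 1 - x ^ L₀ := sub_pos.2 (zpow_lt_one₀ hx hx1 h0)
  have cy : 0 < 1 - y ^ L₀ := sub_pos.2 (zpow_lt_one₀ hy0 hy h0)
  have dx : 0 < 1 - x ^ L₄ := sub_pos.2 (zpow_lt_one₀ hx hx1 h4)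
  have dy : 0 < 1 - y ^ L₄ := sub_pos.2 (zpow_lt_one₀ hy0 hy h4)
  have prod_lt : (1 - x ^ L₁ / (1 - x ^ L₀)) * (1 - x ^ L₃ / (1 - x ^ L₄)) < 1 := by
    have p0 : 0 < x ^ L₁ / (1 - x ^ L₀) := div_pos (zpow_pos hx _) cx
    have p4 : 0 < x ^ L₃ / (1 - x ^ L₄) := div_pos (zpow_pos hx _) dx
    nlinarith
  rcases le_or_gt L₂ 0 with hL2 | hL2
  · exfalso
    have : (1 : ℝ) ≤ x ^ L₂ := one_le_zpow_of_nonpos₀ hx hx1.le hL2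
    linarith
  left
  refine ⟨hL2, ?_⟩
  rcases hxy.eq_or_lt with h | hlt
  · exact h
  exfalso
  have m0 : y ^ L₁ / (1 - y ^ L₀) > x ^ L₁ / (1 - x ^ L₀) := by
    have e1 : x ^ L₁ < y ^ L₁ := zpow_lt_zpow_left₀ h1 hx.le hlt
    have e0 : x ^ L₀ < y ^ L₀ := zpow_lt_zpow_left₀ h0 hx.le hlt
    calc x ^ L₁ / (1 - x ^ L₀) < y ^ L₁ / (1 - x ^ L₀) := div_lt_div_of_pos_right e1 cx
      _ ≤ y ^ L₁ / (1 - y ^ L₀) := div_le_div_of_nonneg_left (zpow_pos hy0 _).le cy (by linarith)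
  have m4 : y ^ L₃ / (1 - y ^ L₄) > x ^ L₃ / (1 - x ^ L₄) := by
    have e3 : x ^ L₃ < y ^ L₃ := zpow_lt_zpow_left₀ h3 hx.le hlt
    have e4 : x ^ L₄ < y ^ L₄ := zpow_lt_zpow_left₀ h4 hx.le hlt
    calc x ^ L₃ / (1 - x ^ L₄) < y ^ L₃ / (1 - x ^ L₄) := div_lt_div_of_pos_right e3 dx
      _ ≤ y ^ L₃ / (1 - y ^ L₄) := div_le_div_of_nonneg_left (zpow_pos hy0 _).le dy (by linarith)
  have m2 : x ^ L₂ < y ^ L₂ := zpow_lt_zpow_left₀ hL2 hx.le hlt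
  have py0 : 0 < 1 - y ^ L₁ / (1 - y ^ L₀) := by linarith
  have py4 : 0 < 1 - y ^ L₃ / (1 - y ^ L₄) := by linarith
  have prod : (1 - y ^ L₁ / (1 - y ^ L₀)) * (1 - y ^ L₃ / (1 - y ^ L₄)) <
      (1 - x ^ L₁ / (1 - x ^ L₀)) * (1 - x ^ L₃ / (1 - x ^ L₄)) :=
    mul_lt_mul'' (by linarith) (by linarith) py0.le py4.le
  rw [fx, fy] at prod
  exact lt_asymm prod m2

/-- **negative-triangle chamber, uniqueness** under `L₂ ≤ L₁ + L₃`: for `L₀, L₁, L₃, L₄ > 0`, two zeros `0 < x < y < 1` with negative left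
triangles are impossible (`(|A|/b₁)(|B|/b₃)` increases strictly, `x^{L₂−L₁−L₃}·C·D` decreases strictly). [this file] -/
theorem unit_six_negChamber_aux (L₀ L₁ L₂ L₃ L₄ : ℤ) (h0 : 0 < L₀) (h1 : 0 < L₁) (h3 : 0 < L₃) (h4 : 0 < L₄) (h2 : L₂ ≤ L₁ + L₃)
    {x y : ℝ} (hx : 0 < x) (hxy : x < y) (hy : y < 1)
    (hxr : (1 - x ^ L₀ - x ^ L₁) * (1 - x ^ L₃ - x ^ L₄) = x ^ L₂ * (1 - x ^ L₀) * (1 - x ^ L₄))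
    (hyr : (1 - y ^ L₀ - y ^ L₁) * (1 - y ^ L₃ - y ^ L₄) = y ^ L₂ * (1 - y ^ L₀) * (1 - y ^ L₄))
    (hAx : 1 - x ^ L₀ - x ^ L₁ < 0) (hAy : 1 - y ^ L₀ - y ^ L₁ < 0) : False := by
  have hy0 : 0 < y := hx.trans hxy
  have hx1 : x < 1 := hxy.trans hy
  have hBx : 1 - x ^ L₃ - x ^ L₄ < 0 := by
    rcases unit_six_discordant_triangle_signs L₀ L₁ L₂ L₃ L₄ h0 h4 hx hx1 hxr with ⟨hA', _⟩ | ⟨_, hB⟩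
    · exact absurd hAx (not_lt.2 hA'.le)
    · exact hB
  have hBy : 1 - y ^ L₃ - y ^ L₄ < 0 := by
    rcases unit_six_discordant_triangle_signs L₀ L₁ L₂ L₃ L₄ h0 h4 hy0 hy hyr with ⟨hA', _⟩ | ⟨_, hB⟩
    · exact absurd hAy (not_lt.2 hA'.le)
    · exact hB
  have pair : ∀ z : ℝ, 0 < z →
      (1 - z ^ L₀ - z ^ L₁) * (1 - z ^ L₃ - z ^ L₄) = z ^ L₂ * (1 - z ^ L₀) * (1 - z ^ L₄) →
      (1 - (1 - z ^ L₀) * z ^ (-L₁)) * (1 - (1 - z ^ L₄) * z ^ (-L₃)) =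
        z ^ (L₂ - L₁ - L₃) * ((1 - z ^ L₀) * (1 - z ^ L₄)) := by
    intro z hz h
    have hz' := hz.ne'
    have e1 : z ^ (-L₁) = (z ^ L₁)⁻¹ := zpow_neg z L₁
    have e3 : z ^ (-L₃) = (z ^ L₃)⁻¹ := zpow_neg z L₃
    have e2 : z ^ (L₂ - L₁ - L₃) = z ^ L₂ * (z ^ L₁)⁻¹ * (z ^ L₃)⁻¹ := by
      rw [zpow_sub₀ hz', zpow_sub₀ hz', div_div, div_eq_mul_inv, mul_inv, mul_assoc]
    rw [e1, e3, e2]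
    have b1 := (zpow_pos hz L₁).ne'
    have b3 := (zpow_pos hz L₃).ne'
    field_simp
    linarith
  have fx := pair x hx hxr
  have fy := pair y hy0 hyr
  have cz : ∀ z : ℝ, 0 < z → z < 1 → 0 < 1 - z ^ L₀ := fun z hz hz1 => sub_pos.2 (zpow_lt_one₀ hz hz1 h0)
  have dz : ∀ z : ℝ, 0 < z → z < 1 → 0 < 1 - z ^ L₄ := fun z hz hz1 => sub_pos.2 (zpow_lt_one₀ hz hz1 h4)
  have posL : ∀ z : ℝ, 0 < z → z < 1 → 1 - z ^ L₀ - z ^ L₁ < 0 → 0 < 1 - (1 - z ^ L₀) * z ^ (-L₁) := by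
    intro z hz hz1 hA
    rw [zpow_neg, sub_pos, ← div_eq_mul_inv, div_lt_one (zpow_pos hz _)]
    linarith
  have posR : ∀ z : ℝ, 0 < z → z < 1 → 1 - z ^ L₃ - z ^ L₄ < 0 → 0 < 1 - (1 - z ^ L₄) * z ^ (-L₃) := by
    intro z hz hz1 hB
    rw [zpow_neg, sub_pos, ← div_eq_mul_inv, div_lt_one (zpow_pos hz _)]
    linarith
  have incL : (1 - x ^ L₀) * x ^ (-L₁) > (1 - y ^ L₀) * y ^ (-L₁) := by
    have e0 : x ^ L₀ < y ^ L₀ := zpow_lt_zpow_left₀ h0 hx.le hxy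
    have e1 : y ^ (-L₁) < x ^ (-L₁) := zpow_lt_zpow_left_of_neg (by omega) hx hxy
    calc (1 - y ^ L₀) * y ^ (-L₁) < (1 - y ^ L₀) * x ^ (-L₁) := mul_lt_mul_of_pos_left e1 (cz y hy0 hy)
      _ ≤ (1 - x ^ L₀) * x ^ (-L₁) := mul_le_mul_of_nonneg_right (by linarith) (zpow_pos hx _).le
  have incR : (1 - x ^ L₄) * x ^ (-L₃) > (1 - y ^ L₄) * y ^ (-L₃) := by
    have e4 : x ^ L₄ < y ^ L₄ := zpow_lt_zpow_left₀ h4 hx.le hxy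
    have e3 : y ^ (-L₃) < x ^ (-L₃) := zpow_lt_zpow_left_of_neg (by omega) hx hxy
    calc (1 - y ^ L₄) * y ^ (-L₃) < (1 - y ^ L₄) * x ^ (-L₃) := mul_lt_mul_of_pos_left e3 (dz y hy0 hy)
      _ ≤ (1 - x ^ L₄) * x ^ (-L₃) := mul_le_mul_of_nonneg_right (by linarith) (zpow_pos hx _).le
  have lhs : (1 - (1 - x ^ L₀) * x ^ (-L₁)) * (1 - (1 - x ^ L₄) * x ^ (-L₃)) <
      (1 - (1 - y ^ L₀) * y ^ (-L₁)) * (1 - (1 - y ^ L₄) * y ^ (-L₃)) :=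
    mul_lt_mul'' (by linarith) (by linarith) (posL x hx hx1 hAx).le (posR x hx hx1 hBx).le
  have decM : y ^ (L₂ - L₁ - L₃) ≤ x ^ (L₂ - L₁ - L₃) := by
    rcases (show L₂ - L₁ - L₃ ≤ 0 by omega).eq_or_lt with h | h
    · rw [h, zpow_zero, zpow_zero]
    · exact (zpow_lt_zpow_left_of_neg h hx hxy).le
  have decCD : (1 - y ^ L₀) * (1 - y ^ L₄) < (1 - x ^ L₀) * (1 - x ^ L₄) := by
    have e0 : x ^ L₀ < y ^ L₀ := zpow_lt_zpow_left₀ h0 hx.le hxy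
    have e4 : x ^ L₄ < y ^ L₄ := zpow_lt_zpow_left₀ h4 hx.le hxy
    exact mul_lt_mul'' (by linarith) (by linarith) (cz y hy0 hy).le (dz y hy0 hy).le
  have rhs : y ^ (L₂ - L₁ - L₃) * ((1 - y ^ L₀) * (1 - y ^ L₄)) < x ^ (L₂ - L₁ - L₃) * ((1 - x ^ L₀) * (1 - x ^ L₄)) :=
    mul_lt_mul' decM decCD (mul_pos (cz y hy0 hy) (dz y hy0 hy)).le (zpow_pos hx _)
  rw [fx, fy] at lhs
  exact lt_asymm lhs rhs

/-! ### Signs of the determinant at `1/4` and at the triangle zeros -/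

/-- `D₆(1/4) > 0` when `L₀, L₁, L₃, L₄ > 0` and `L₂ > 0` (`AB ≥ 1/4 > b₂CD`). [this file] -/
theorem unit_six_outerPos_eval_quarter_pos
    (h0 : 0 < (2 * f 0 : ℤ) - d 0 - d 1) (h1 : 0 < (2 * f 1 : ℤ) - d 1 - d 2) (h2 : 0 < (2 * f 2 : ℤ) - d 2 - d 3)
    (h3 : 0 < (2 * f 3 : ℤ) - d 3 - d 4) (h4 : 0 < (2 * f 4 : ℤ) - d 4 - d 5) :
    0 < (pathDet (fun _ => (1 : ℝ)) d (fun _ => (1 : ℝ)) f 6).eval (1 / 4) := by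
  have hq : (1 / 4 : ℝ) ≠ 0 := by norm_num
  have hq0 : (0 : ℝ) < 1 / 4 := by norm_num
  have hq1 : (1 / 4 : ℝ) < 1 := by norm_num
  rw [eval_unit_six_eq d f _ hq]
  have hA := triangle_quarter_ge _ _ h0 h1
  have hB := triangle_quarter_ge _ _ h3 h4
  have b2 : (1 / 4 : ℝ) ^ ((2 * f 2 : ℤ) - d 2 - d 3) ≤ 1 / 4 := by
    have := zpow_le_zpow_right_of_le_one₀ hq0 hq1.le (show (1 : ℤ) ≤ (2 * f 2 : ℤ) - d 2 - d 3 by omega)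
    rwa [zpow_one] at this
  have c0 : 0 < 1 - (1 / 4 : ℝ) ^ ((2 * f 0 : ℤ) - d 0 - d 1) := sub_pos.2 (zpow_lt_one₀ hq0 hq1 h0)
  have c4 : 0 < 1 - (1 / 4 : ℝ) ^ ((2 * f 4 : ℤ) - d 4 - d 5) := sub_pos.2 (zpow_lt_one₀ hq0 hq1 h4)
  have c0' : 1 - (1 / 4 : ℝ) ^ ((2 * f 0 : ℤ) - d 0 - d 1) < 1 := by linarith [zpow_pos hq0 ((2 * f 0 : ℤ) - d 0 - d 1)]
  have c4' : 1 - (1 / 4 : ℝ) ^ ((2 * f 4 : ℤ) - d 4 - d 5) < 1 := by linarith [zpow_pos hq0 ((2 * f 4 : ℤ) - d 4 - d 5)]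
  have p2 := zpow_pos hq0 ((2 * f 2 : ℤ) - d 2 - d 3)
  apply mul_pos (pow_pos hq0 _)
  have hCD : (1 - (1 / 4 : ℝ) ^ ((2 * f 0 : ℤ) - d 0 - d 1)) * (1 - (1 / 4 : ℝ) ^ ((2 * f 4 : ℤ) - d 4 - d 5)) < 1 := by nlinarith
  have hAB := mul_le_mul hA hB (by norm_num) (by linarith)
  have hR := mul_lt_mul' b2 hCD (mul_pos c0 c4).le (by norm_num : (0:ℝ) < 1 / 4)
  nlinarith

/-- at a zero `a ∈ (0, 1)` of the LEFT triangle the determinant is negative: `D₆(a) = −a^E · b₂ C D < 0`. [this file] -/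
theorem unit_six_eval_neg_of_left_triangle_zero (h0 : 0 < (2 * f 0 : ℤ) - d 0 - d 1) (h4 : 0 < (2 * f 4 : ℤ) - d 4 - d 5)
    {a : ℝ} (ha0 : 0 < a) (ha1 : a < 1) (hA : 1 - a ^ ((2 * f 0 : ℤ) - d 0 - d 1) - a ^ ((2 * f 1 : ℤ) - d 1 - d 2) = 0) :
    (pathDet (fun _ => (1 : ℝ)) d (fun _ => (1 : ℝ)) f 6).eval a < 0 := by
  rw [eval_unit_six_eq d f _ ha0.ne', hA, zero_mul, zero_sub]
  apply mul_neg_of_pos_of_neg (pow_pos ha0 _)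
  have c0 : 0 < 1 - a ^ ((2 * f 0 : ℤ) - d 0 - d 1) := sub_pos.2 (zpow_lt_one₀ ha0 ha1 h0)
  have c4 : 0 < 1 - a ^ ((2 * f 4 : ℤ) - d 4 - d 5) := sub_pos.2 (zpow_lt_one₀ ha0 ha1 h4)
  have := mul_pos (mul_pos (zpow_pos ha0 ((2 * f 2 : ℤ) - d 2 - d 3)) c0) c4
  linarith

/-- at a zero `b ∈ (0, 1)` of the RIGHT triangle the determinant is negative as well. [this file] -/
theorem unit_six_eval_neg_of_right_triangle_zero (h0 : 0 < (2 * f 0 : ℤ) - d 0 - d 1) (h4 : 0 < (2 * f 4 : ℤ) - d 4 - d 5)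
    {b : ℝ} (hb0 : 0 < b) (hb1 : b < 1) (hB : 1 - b ^ ((2 * f 3 : ℤ) - d 3 - d 4) - b ^ ((2 * f 4 : ℤ) - d 4 - d 5) = 0) :
    (pathDet (fun _ => (1 : ℝ)) d (fun _ => (1 : ℝ)) f 6).eval b < 0 := by
  rw [eval_unit_six_eq d f _ hb0.ne', hB, mul_zero, zero_sub]
  apply mul_neg_of_pos_of_neg (pow_pos hb0 _)
  have c0 : 0 < 1 - b ^ ((2 * f 0 : ℤ) - d 0 - d 1) := sub_pos.2 (zpow_lt_one₀ hb0 hb1 h0)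
  have c4 : 0 < 1 - b ^ ((2 * f 4 : ℤ) - d 4 - d 5) := sub_pos.2 (zpow_lt_one₀ hb0 hb1 h4)
  have := mul_pos (mul_pos (zpow_pos hb0 ((2 * f 2 : ℤ) - d 2 - d 3)) c0) c4
  linarith

/-! ### Chamber counts -/

/-- **POSITIVE-TRIANGLE CHAMBER: exactly `[L₂ > 0]` zeros** (for `L₀, L₁, L₃, L₄ > 0`). [this file] -/
theorem card_posRoots_posTriangle_unit_six_eq
    (h0 : 0 < (2 * f 0 : ℤ) - d 0 - d 1) (h1 : 0 < (2 * f 1 : ℤ) - d 1 - d 2)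
    (h3 : 0 < (2 * f 3 : ℤ) - d 3 - d 4) (h4 : 0 < (2 * f 4 : ℤ) - d 4 - d 5) :
    ((pathDet (fun _ => (1 : ℝ)) d (fun _ => (1 : ℝ)) f 6).roots.toFinset.filter
      (fun x => 0 < x ∧ x < 1 ∧ 0 < 1 - x ^ ((2 * f 0 : ℤ) - d 0 - d 1) - x ^ ((2 * f 1 : ℤ) - d 1 - d 2))).card =
      if 0 < (2 * f 2 : ℤ) - d 2 - d 3 then 1 else 0 := by
  set P := pathDet (fun _ => (1 : ℝ)) d (fun _ => (1 : ℝ)) f 6 with hP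
  set S := P.roots.toFinset.filter
      (fun x => 0 < x ∧ x < 1 ∧ 0 < 1 - x ^ ((2 * f 0 : ℤ) - d 0 - d 1) - x ^ ((2 * f 1 : ℤ) - d 1 - d 2)) with hS
  have mem : ∀ x, x ∈ S → (0 < x ∧ x < 1 ∧ 0 < 1 - x ^ ((2 * f 0 : ℤ) - d 0 - d 1) - x ^ ((2 * f 1 : ℤ) - d 1 - d 2)) ∧
      (1 - x ^ ((2 * f 0 : ℤ) - d 0 - d 1) - x ^ ((2 * f 1 : ℤ) - d 1 - d 2)) *
      (1 - x ^ ((2 * f 3 : ℤ) - d 3 - d 4) - x ^ ((2 * f 4 : ℤ) - d 4 - d 5)) =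
      x ^ ((2 * f 2 : ℤ) - d 2 - d 3) * (1 - x ^ ((2 * f 0 : ℤ) - d 0 - d 1)) * (1 - x ^ ((2 * f 4 : ℤ) - d 4 - d 5)) := by
    intro x hx
    simp only [hS, Finset.mem_filter, Multiset.mem_toFinset, mem_roots', IsRoot.def] at hx
    exact ⟨hx.2, unit_six_root_eq d f hx.2.1 hx.1.2⟩
  have hle : S.card ≤ 1 := Finset.card_le_one.2 fun x hx y hy => by
    obtain ⟨⟨hx0, hx1, hxA⟩, hxr⟩ := mem x hx
    obtain ⟨⟨hy0, hy1, hyA⟩, hyr⟩ := mem y hy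
    rcases le_total x y with hxy | hyx
    · rcases unit_six_posChamber_aux _ _ _ _ _ h0 h1 h3 h4 hx0 hxy hy1 hxr hyr hxA hyA with ⟨-, h⟩ | h
      · exact h
      · exact h.elim
    · rcases unit_six_posChamber_aux _ _ _ _ _ h0 h1 h3 h4 hy0 hyx hx1 hyr hxr hyA hxA with ⟨-, h⟩ | h
      · exact h.symm
      · exact h.elim
  split_ifs with h2
  · -- existence: `D₆(1/4) > 0 > D₆(min(α, β))`
    obtain ⟨a, ha1, ha2, haA⟩ := exists_triangle_root _ _ h0 h1
    obtain ⟨b, hb1, hb2, hbB⟩ := exists_triangle_root _ _ h3 h4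
    have hpos := unit_six_outerPos_eval_quarter_pos d f h0 h1 h2 h3 h4
    have ha0 : 0 < a := by linarith
    have hb0 : 0 < b := by linarith
    have key : ∀ m : ℝ, 1 / 4 < m → m ≤ a → m ≤ b → P.eval m < 0 → 1 ≤ S.card := by
      intro m hm1 hma hmb hneg
      have hcont : ContinuousOn (fun x => P.eval x) (Set.Icc (1 / 4 : ℝ) m) := P.continuous.continuousOn
      obtain ⟨r, ⟨hr1, hr2⟩, hr⟩ := intermediate_value_Ioo' hm1.le hcont ⟨hneg, hpos⟩
      have hr0 : 0 < r := by linarith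
      have hrA : 0 < 1 - r ^ ((2 * f 0 : ℤ) - d 0 - d 1) - r ^ ((2 * f 1 : ℤ) - d 1 - d 2) := by
        have := triangle_strictAnti _ _ h0 h1 hr0 (hr2.trans_le hma)
        linarith
      refine Finset.card_pos.2 ⟨r, ?_⟩
      simp only [hS, Finset.mem_filter, Multiset.mem_toFinset, mem_roots', IsRoot.def]
      exact ⟨⟨unit_six_ne_zero d f, hr⟩, hr0, by linarith, hrA⟩
    have hge : 1 ≤ S.card := by
      rcases le_total a b with hab | hba
      · exact key a ha1 le_rfl hab (unit_six_eval_neg_of_left_triangle_zero d f h0 h4 ha0 ha2 haA)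
      · exact key b hb1 hba le_rfl (unit_six_eval_neg_of_right_triangle_zero d f h0 h4 hb0 hb2 hbB)
    omega
  · refine Finset.card_eq_zero.2 (Finset.eq_empty_iff_forall_notMem.2 fun x hx => ?_)
    obtain ⟨⟨hx0, hx1, hxA⟩, hxr⟩ := mem x hx
    rcases unit_six_posChamber_aux _ _ _ _ _ h0 h1 h3 h4 hx0 le_rfl hx1 hxr hxr hxA hxA with ⟨h, -⟩ | h
    · exact h2 h
    · exact h

/-- **NEGATIVE-TRIANGLE CHAMBER: exactly one zero** when `L₀, L₁, L₃, L₄ > 0` and `L₂ ≤ L₁ + L₃`. [this file] -/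
theorem card_posRoots_negTriangle_unit_six_eq_one
    (h0 : 0 < (2 * f 0 : ℤ) - d 0 - d 1) (h1 : 0 < (2 * f 1 : ℤ) - d 1 - d 2)
    (h3 : 0 < (2 * f 3 : ℤ) - d 3 - d 4) (h4 : 0 < (2 * f 4 : ℤ) - d 4 - d 5)
    (h2 : (2 * f 2 : ℤ) - d 2 - d 3 ≤ ((2 * f 1 : ℤ) - d 1 - d 2) + ((2 * f 3 : ℤ) - d 3 - d 4)) :
    ((pathDet (fun _ => (1 : ℝ)) d (fun _ => (1 : ℝ)) f 6).roots.toFinset.filter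
      (fun x => 0 < x ∧ x < 1 ∧ 1 - x ^ ((2 * f 0 : ℤ) - d 0 - d 1) - x ^ ((2 * f 1 : ℤ) - d 1 - d 2) < 0)).card = 1 := by
  set P := pathDet (fun _ => (1 : ℝ)) d (fun _ => (1 : ℝ)) f 6 with hP
  set S := P.roots.toFinset.filter
      (fun x => 0 < x ∧ x < 1 ∧ 1 - x ^ ((2 * f 0 : ℤ) - d 0 - d 1) - x ^ ((2 * f 1 : ℤ) - d 1 - d 2) < 0) with hS
  have mem : ∀ x, x ∈ S → (0 < x ∧ x < 1 ∧ 1 - x ^ ((2 * f 0 : ℤ) - d 0 - d 1) - x ^ ((2 * f 1 : ℤ) - d 1 - d 2) < 0) ∧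
      (1 - x ^ ((2 * f 0 : ℤ) - d 0 - d 1) - x ^ ((2 * f 1 : ℤ) - d 1 - d 2)) *
      (1 - x ^ ((2 * f 3 : ℤ) - d 3 - d 4) - x ^ ((2 * f 4 : ℤ) - d 4 - d 5)) =
      x ^ ((2 * f 2 : ℤ) - d 2 - d 3) * (1 - x ^ ((2 * f 0 : ℤ) - d 0 - d 1)) * (1 - x ^ ((2 * f 4 : ℤ) - d 4 - d 5)) := by
    intro x hx
    simp only [hS, Finset.mem_filter, Multiset.mem_toFinset, mem_roots', IsRoot.def] at hx
    exact ⟨hx.2, unit_six_root_eq d f hx.2.1 hx.1.2⟩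
  have hle : S.card ≤ 1 := Finset.card_le_one.2 fun x hx y hy => by
    obtain ⟨⟨hx0, hx1, hxA⟩, hxr⟩ := mem x hx
    obtain ⟨⟨hy0, hy1, hyA⟩, hyr⟩ := mem y hy
    by_contra hne
    rcases lt_or_gt_of_ne hne with hlt | hgt
    · exact unit_six_negChamber_aux _ _ _ _ _ h0 h1 h3 h4 h2 hx0 hlt hy1 hxr hyr hxA hyA
    · exact unit_six_negChamber_aux _ _ _ _ _ h0 h1 h3 h4 h2 hy0 hgt hx1 hyr hxr hyA hxA
  obtain ⟨a, ha1, ha2, haA⟩ := exists_triangle_root _ _ h0 h1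
  obtain ⟨b, hb1, hb2, hbB⟩ := exists_triangle_root _ _ h3 h4
  have ha0 : 0 < a := by linarith
  have hb0 : 0 < b := by linarith
  have hone : 0 < P.eval 1 := by rw [hP, eval_unit_six_one]; exact one_pos
  have key : ∀ m : ℝ, 0 < m → m < 1 → a ≤ m → b ≤ m → P.eval m < 0 → 1 ≤ S.card := by
    intro m hm0 hm1 hma hmb hneg
    have hcont : ContinuousOn (fun x => P.eval x) (Set.Icc m 1) := P.continuous.continuousOn
    obtain ⟨r, ⟨hr1, hr2⟩, hr⟩ := intermediate_value_Ioo hm1.le hcont ⟨hneg, hone⟩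
    have hr0 : 0 < r := hm0.trans hr1
    have hrA : 1 - r ^ ((2 * f 0 : ℤ) - d 0 - d 1) - r ^ ((2 * f 1 : ℤ) - d 1 - d 2) < 0 := by
      have := triangle_strictAnti _ _ h0 h1 ha0 (hma.trans_lt hr1)
      linarith
    refine Finset.card_pos.2 ⟨r, ?_⟩
    simp only [hS, Finset.mem_filter, Multiset.mem_toFinset, mem_roots', IsRoot.def]
    exact ⟨⟨unit_six_ne_zero d f, hr⟩, hr0, hr2, hrA⟩
  have hge : 1 ≤ S.card := by
    rcases le_total a b with hab | hba
    · exact key b hb0 hb2 hab le_rfl (unit_six_eval_neg_of_right_triangle_zero d f h0 h4 hb0 hb2 hbB)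
    · exact key a ha0 ha2 le_rfl hba (unit_six_eval_neg_of_left_triangle_zero d f h0 h4 ha0 ha2 haA)
  omega

/-- **TOTAL COUNT in the outer-positive classes** (`L₀, L₁, L₃, L₄ > 0`) under `L₂ ≤ L₁ + L₃`:
`#(positive zeros) = [L₂ > 0] + 1 + [L₂ > max(L₁−L₀,0) + max(L₃−L₄,0)]`. [this file] -/
theorem card_posRoots_unit_six_outerPos_eq
    (h0 : 0 < (2 * f 0 : ℤ) - d 0 - d 1) (h1 : 0 < (2 * f 1 : ℤ) - d 1 - d 2)
    (h3 : 0 < (2 * f 3 : ℤ) - d 3 - d 4) (h4 : 0 < (2 * f 4 : ℤ) - d 4 - d 5)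
    (h2 : (2 * f 2 : ℤ) - d 2 - d 3 ≤ ((2 * f 1 : ℤ) - d 1 - d 2) + ((2 * f 3 : ℤ) - d 3 - d 4)) :
    ((pathDet (fun _ => (1 : ℝ)) d (fun _ => (1 : ℝ)) f 6).roots.toFinset.filter (fun x => 0 < x)).card =
      (if 0 < (2 * f 2 : ℤ) - d 2 - d 3 then 1 else 0) + 1 +
      (if max (((2 * f 1 : ℤ) - d 1 - d 2) - ((2 * f 0 : ℤ) - d 0 - d 1)) 0 +
          max (((2 * f 3 : ℤ) - d 3 - d 4) - ((2 * f 4 : ℤ) - d 4 - d 5)) 0 < (2 * f 2 : ℤ) - d 2 - d 3 then 1 else 0) := by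
  set P := pathDet (fun _ => (1 : ℝ)) d (fun _ => (1 : ℝ)) f 6 with hP
  set A : ℝ → ℝ := fun x => 1 - x ^ ((2 * f 0 : ℤ) - d 0 - d 1) - x ^ ((2 * f 1 : ℤ) - d 1 - d 2) with hAdef
  set S := P.roots.toFinset.filter (fun x => 0 < x) with hS
  set S₁ := P.roots.toFinset.filter (fun x => 0 < x ∧ x < 1 ∧ 0 < A x) with hS₁
  set S₂ := P.roots.toFinset.filter (fun x => 0 < x ∧ x < 1 ∧ A x < 0) with hS₂
  set S₃ := P.roots.toFinset.filter (fun x => 1 < x) with hS₃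
  have hsplit : S = S₁ ∪ S₂ ∪ S₃ := by
    ext x
    simp only [hS, hS₁, hS₂, hS₃, Finset.mem_union, Finset.mem_filter, Multiset.mem_toFinset, mem_roots', IsRoot.def]
    constructor
    · rintro ⟨⟨hP0, hr⟩, hx0⟩
      rcases lt_trichotomy x 1 with hx1 | hx1 | hx1
      · rcases lt_trichotomy (A x) 0 with hA | hA | hA
        · exact Or.inl (Or.inr ⟨⟨hP0, hr⟩, hx0, hx1, hA⟩)
        · exact absurd (unit_six_eval_neg_of_left_triangle_zero d f h0 h4 hx0 hx1 hA) (by rw [hr]; exact lt_irrefl 0)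
        · exact Or.inl (Or.inl ⟨⟨hP0, hr⟩, hx0, hx1, hA⟩)
      · subst hx1; rw [hP, eval_unit_six_one] at hr; exact absurd hr one_ne_zero
      · exact Or.inr ⟨⟨hP0, hr⟩, hx1⟩
    · rintro ((⟨hPr, hx0, -, -⟩ | ⟨hPr, hx0, -, -⟩) | ⟨hPr, hx1⟩)
      · exact ⟨hPr, hx0⟩
      · exact ⟨hPr, hx0⟩
      · exact ⟨hPr, one_pos.trans hx1⟩
  have d12 : Disjoint S₁ S₂ := by
    rw [Finset.disjoint_filter]; intro x _ h1' h2'; linarith [h1'.2.2, h2'.2.2]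
  have d13 : Disjoint (S₁ ∪ S₂) S₃ := by
    rw [Finset.disjoint_left]
    intro x hx hx3
    simp only [hS₁, hS₂, hS₃, Finset.mem_union, Finset.mem_filter] at hx hx3
    rcases hx with h | h <;> linarith [h.2.2.1, hx3.2]
  rw [hsplit, Finset.card_union_of_disjoint d13, Finset.card_union_of_disjoint d12]
  have c1 := card_posRoots_posTriangle_unit_six_eq d f h0 h1 h3 h4
  have c2 := card_posRoots_negTriangle_unit_six_eq_one d f h0 h1 h3 h4 h2
  rw [← hP] at c1 c2
  rw [c1, c2]
  congr 1
  split_ifs with hs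
  · have c3 := card_posRoots_gt_one_unit_six_eq_one_of_gt d f h0 h4 hs
    rw [← hP] at c3; exact c3
  · have c3 := card_posRoots_gt_one_unit_six_eq_zero_of_le d f h0 h4 (not_lt.1 hs)
    rw [← hP] at c3; exact c3

end StaticTridiagonalRealUnit
end Summit.ValiantsHypothesis.ValiantsHypothesis.Theorems.KPlusLogSqLaw
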